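import Mathlib.Geometry.Manifold.VectorBundle.CovariantDerivative.Torsion
import Mathlib.Analysis.Calculus.FDeriv.Symmetric
import Literature.Geometry.Lorentzian.CoordinateFrames
import HarnessLib

/-!
# Two-parameter maps: `x_{uv} = x_{vu}` for a torsion-free connection

For a two-parameter map `x : ℝ × ℝ → M` into a manifold with a covariant derivative `∇` on `TM`
(O'Neill, *Semi-Riemannian geometry* (1983), Ch. 4, "Two-parameter maps", pp. 122–123), the
partial velocities `x_u = dx(∂_u)`, `x_v = dx(∂_v)` are vector fields on `x`, and their partial
covariant derivatives are covariant derivatives along the parameter curves: `x_{uv}(u₀, v₀)` is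
the covariant derivative at `v₀` of the vector field `v ↦ x_u(u₀, v)` on the curve `v ↦ x(u₀, v)`.
**O'Neill 1983, Ch. 4, Prop. 44 (1):** *if `x` is a two-parameter map into a semi-Riemannian
manifold, then `x_{uv} = x_{vu}`.* The printed proof: in coordinates
`x_{uv} = ∑_k {∂²xᵏ/∂v∂u + ∑_{ij} Γᵏᵢⱼ (∂xⁱ/∂u)(∂xʲ/∂v)} ∂_k`, "this formula is symmetric in `u`
and `v`, since `Γᵢⱼ` is symmetric in `i` and `j`"; and `Γᵏᵢⱼ = Γᵏⱼᵢ` because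
`[∂ᵢ, ∂ⱼ] = 0` and the connection is torsion-free (O'Neill 1983, Ch. 3, remark after Def. 12:
"since `[∂ᵢ, ∂ⱼ] = 0`, it follows from (D4) that `D_{∂ᵢ}∂ⱼ = D_{∂ⱼ}∂ᵢ`").

This file proves exactly this, for an arbitrary covariant derivative `cov` on `TM` with
`cov.torsion = 0` (Mathlib's `CovariantDerivative.torsion`) and the covariant derivative along
curves `covariantDerivAlong` of `Geodesic.lean` (the local-frame formula
`DW/dt = ∑ᵢ (cⁱ)' sᵢ + ∑ᵢ cⁱ ∇_{γ'} sᵢ` in the canonical frame at the base point):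

* `covariantDerivative_localFrame_comm` — for the coordinate frame `sᵢ` of the chart at `x₁`
  (the local frame of the trivialisation of `TM` at `x₁`), `∇_{sᵢ} sⱼ = ∇_{sⱼ} sᵢ` at `x₁` for
  torsion-free `∇` (symmetry of the Christoffel symbols), since `[sᵢ, sⱼ] = 0`
  (`mlieBracket_localFrame_trivializationAt` of `CoordinateFrames.lean`);
* `deriv_deriv_comm_of_contDiffAt` — equality (and existence) of the mixed second partial
  derivatives of a `C²` map `ℝ × ℝ → F` (Schwarz; Mathlib's `ContDiffAt.isSymmSndFDerivAt`);
* the partial velocity fields of a `C²` two-parameter map have differentiable lifts to `TM`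
  (`mdifferentiableAt_lift_velocity_curry_right/left`), their fibre coordinates in the
  trivialisation at the base point being the partial derivatives of the chart expression
  (`trivializationAt_velocity_curry_right/left`);
* `covariantDerivAlong_velocity_comm` — **the symmetry lemma** `x_{uv} = x_{vu}` at `(t₀, s₀)`;
* `contMDiffAt_curveThrough` — the chart-straight curves `curveThrough` of `Geodesic.lean` are
  smooth (needed to build two-parameter maps `(t, s) ↦ F t (curveThrough p v s)` from a family of
  maps `F t`, as in first-variation computations).

Partial velocities are written with `velocity` of `Geodesic.lean`: `x_s(t, s) = velocity I (x t) s`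
and `x_t(t, s) = velocity I (fun t ↦ x t s) t`. Joint regularity is the hypothesis
`ContMDiffAt (𝓘(ℝ, ℝ).prod 𝓘(ℝ, ℝ)) I 2 (uncurry x) (t₀, s₀)`.

## References

* B. O'Neill, *Semi-Riemannian geometry with applications to relativity*, Academic Press 1983,
  Ch. 4, pp. 122–123, "Two-parameter maps" and Prop. 44 (1) (`x_{uv} = x_{vu}`), with its
  coordinate proof; Ch. 3, Def. 12 and the remark following it (`Γᵏᵢⱼ = Γᵏⱼᵢ` from `[∂ᵢ, ∂ⱼ] = 0`
  and (D4)); Ch. 3, Prop. 18 (coordinate formula for the induced covariant derivative).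
* J. M. Lee, *Introduction to Riemannian Manifolds*, 2nd ed., Springer 2018, Lemma 6.2
  (Symmetry Lemma), for comparison.
-/

noncomputable section

open Bundle Set Filter VectorField Function
open scoped Manifold ContDiff Topology

namespace Literature.Geometry.Lorentzian

/-! ### Calculus: mixed partial derivatives of a `C²` map on `ℝ × ℝ` -/

section Calculus

variable {F : Type*} [NormedAddCommGroup F] [NormedSpace ℝ F] {f : ℝ × ℝ → F}

/-- The partial derivative in the second variable is the Fréchet derivative on `(0, 1)`:
`∂_s f(t, s) = Df(t, s)(0, 1)` (chain rule along `s ↦ (t, s)`). [folklore] -/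
theorem hasDerivAt_curry_right {t s : ℝ} (hf : DifferentiableAt ℝ f (t, s)) :
    HasDerivAt (fun s' ↦ f (t, s')) (fderiv ℝ f (t, s) (0, 1)) s := by
  have hc : HasDerivAt (fun s' : ℝ ↦ ((t, s') : ℝ × ℝ)) ((0 : ℝ), (1 : ℝ)) s :=
    (hasDerivAt_const s t).prodMk (hasDerivAt_id s)
  exact hf.hasFDerivAt.comp_hasDerivAt s hc

/-- The partial derivative in the first variable is the Fréchet derivative on `(1, 0)`:
`∂_t f(t, s) = Df(t, s)(1, 0)`. [folklore] -/
theorem hasDerivAt_curry_left {t s : ℝ} (hf : DifferentiableAt ℝ f (t, s)) :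
    HasDerivAt (fun t' ↦ f (t', s)) (fderiv ℝ f (t, s) (1, 0)) t := by
  have hc : HasDerivAt (fun t' : ℝ ↦ ((t', s) : ℝ × ℝ)) ((1 : ℝ), (0 : ℝ)) t :=
    (hasDerivAt_id t).prodMk (hasDerivAt_const t s)
  exact hf.hasFDerivAt.comp_hasDerivAt t hc

/-- **Schwarz's theorem for a `C²` map on the plane**, in the form used for two-parameter maps:
if `f : ℝ × ℝ → F` is `C²` at `(t₀, s₀)`, the iterated partial derivatives
`∂_t ∂_s f` and `∂_s ∂_t f` both exist at `(t₀, s₀)` and both equal `D²f(t₀, s₀)(1,0)(0,1)`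
(the second derivative is symmetric, Mathlib's `ContDiffAt.isSymmSndFDerivAt`; the inner partial
derivatives are `Df(·)(0,1)`, `Df(·)(1,0)` near the point). [folklore] -/
theorem deriv_deriv_comm_of_contDiffAt {t₀ s₀ : ℝ} (hf : ContDiffAt ℝ 2 f (t₀, s₀)) :
    HasDerivAt (fun t ↦ deriv (fun s ↦ f (t, s)) s₀)
        ((fderiv ℝ (fderiv ℝ f) (t₀, s₀) (1, 0)) (0, 1)) t₀ ∧
      HasDerivAt (fun s ↦ deriv (fun t ↦ f (t, s)) t₀)
        ((fderiv ℝ (fderiv ℝ f) (t₀, s₀) (1, 0)) (0, 1)) s₀ := by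
  have hev : ∀ᶠ p in 𝓝 (t₀, s₀), DifferentiableAt ℝ f p := by
    filter_upwards [hf.eventually (by simp)] with p hp
    exact hp.differentiableAt two_ne_zero
  have hD : HasFDerivAt (fderiv ℝ f) (fderiv ℝ (fderiv ℝ f) (t₀, s₀)) (t₀, s₀) :=
    ((hf.fderiv_right (m := 1) le_rfl).differentiableAt one_ne_zero).hasFDerivAt
  have hsymm := hf.isSymmSndFDerivAt (by simp)
  constructor
  · have h1 : (fun t ↦ deriv (fun s ↦ f (t, s)) s₀) =ᶠ[𝓝 t₀]
        fun t ↦ fderiv ℝ f (t, s₀) (0, 1) := by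
      have hc : Tendsto (fun t : ℝ ↦ ((t, s₀) : ℝ × ℝ)) (𝓝 t₀) (𝓝 (t₀, s₀)) :=
        (continuous_id.prodMk continuous_const).tendsto t₀
      filter_upwards [hc.eventually hev] with t ht
      exact (hasDerivAt_curry_right ht).deriv
    have hc : HasDerivAt (fun t' : ℝ ↦ ((t', s₀) : ℝ × ℝ)) ((1 : ℝ), (0 : ℝ)) t₀ :=
      (hasDerivAt_id t₀).prodMk (hasDerivAt_const t₀ s₀)
    have h2 : HasDerivAt (fun t ↦ fderiv ℝ f (t, s₀)) (fderiv ℝ (fderiv ℝ f) (t₀, s₀) (1, 0)) t₀ :=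
      hD.comp_hasDerivAt t₀ hc
    have h3 := h2.clm_apply (hasDerivAt_const t₀ ((0 : ℝ), (1 : ℝ)))
    simp only [map_zero, add_zero] at h3
    exact h3.congr_of_eventuallyEq h1
  · have h1 : (fun s ↦ deriv (fun t ↦ f (t, s)) t₀) =ᶠ[𝓝 s₀]
        fun s ↦ fderiv ℝ f (t₀, s) (1, 0) := by
      have hc : Tendsto (fun s : ℝ ↦ ((t₀, s) : ℝ × ℝ)) (𝓝 s₀) (𝓝 (t₀, s₀)) :=
        (continuous_const.prodMk continuous_id).tendsto s₀
      filter_upwards [hc.eventually hev] with s hs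
      exact (hasDerivAt_curry_left hs).deriv
    have hc : HasDerivAt (fun s' : ℝ ↦ ((t₀, s') : ℝ × ℝ)) ((0 : ℝ), (1 : ℝ)) s₀ :=
      (hasDerivAt_const s₀ t₀).prodMk (hasDerivAt_id s₀)
    have h2 : HasDerivAt (fun s ↦ fderiv ℝ f (t₀, s)) (fderiv ℝ (fderiv ℝ f) (t₀, s₀) (0, 1)) s₀ :=
      hD.comp_hasDerivAt s₀ hc
    have h3 := h2.clm_apply (hasDerivAt_const s₀ ((1 : ℝ), (0 : ℝ)))
    simp only [map_zero, add_zero] at h3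
    rw [hsymm (1, 0) (0, 1)]
    exact h3.congr_of_eventuallyEq h1

end Calculus

variable {E : Type*} [NormedAddCommGroup E] [NormedSpace ℝ E] {H : Type*} [TopologicalSpace H]
  {I : ModelWithCorners ℝ E H} {M : Type*} [TopologicalSpace M] [ChartedSpace H M]
  [IsManifold I ∞ M]

/-! ### Symmetric Christoffel symbols of a torsion-free connection -/

section Frame

/-- **Symmetry of the Christoffel symbols of a torsion-free connection**: for a covariant
derivative `∇` on `TM` with vanishing torsion and the coordinate frame `sₖ` of the chart at `x₁`,
`∇_{sₖ} sₗ = ∇_{sₗ} sₖ` at `x₁` (in Mathlib's argument order, `cov sₗ x₁ (sₖ x₁) = cov sₖ x₁ (sₗ x₁)`),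
i.e. `Γᵐₖₗ = Γᵐₗₖ`: torsion-freeness gives `∇_{sₖ} sₗ - ∇_{sₗ} sₖ = [sₖ, sₗ]`, which vanishes
(`mlieBracket_localFrame_trivializationAt`). O'Neill 1983, Ch. 3, remark after Def. 12
(`Γᵏᵢⱼ = Γᵏⱼᵢ`, from `[∂ᵢ, ∂ⱼ] = 0` and (D4)). [cite: ONeill1983, Ch. 3, Def. 12 and remark] -/
theorem covariantDerivative_localFrame_comm [FiniteDimensional ℝ E] [CompleteSpace E]
    (cov : CovariantDerivative I E (TangentSpace I : M → Type _)) (hcov : cov.torsion = 0)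
    {ι : Type*} (b : Module.Basis ι ℝ E) (x₁ : M) (k l : ι) :
    cov ((trivializationAt E (TangentSpace I : M → Type _) x₁).localFrame b l) x₁
        ((trivializationAt E (TangentSpace I : M → Type _) x₁).localFrame b k x₁) =
      cov ((trivializationAt E (TangentSpace I : M → Type _) x₁).localFrame b k) x₁
        ((trivializationAt E (TangentSpace I : M → Type _) x₁).localFrame b l x₁) := by
  have hx : x₁ ∈ (trivializationAt E (TangentSpace I : M → Type _) x₁).baseSet :=
    FiberBundle.mem_baseSet_trivializationAt' x₁
  have hs : ∀ j, MDiffAt (T% ((trivializationAt E (TangentSpace I : M → Type _) x₁).localFrame b j))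
      x₁ := fun j ↦
    (contMDiffAt_localFrame_of_mem 1 _ b j hx).mdifferentiableAt one_ne_zero
  have h := (cov.torsion_eq_zero_iff).1 hcov (hs k) (hs l)
  rwa [mlieBracket_localFrame_trivializationAt b (mem_chart_source H x₁), sub_eq_zero] at h

end Frame

/-! ### Chart-straight curves are smooth -/

section CurveThrough

variable {n : ℕ∞ω}

omit [IsManifold I ∞ M] in
/-- The chart-straight curve `curveThrough I p v : s ↦ φ⁻¹(φ p + s v)` (`φ = extChartAt I p`) of
`Geodesic.lean` is `C^n` at every parameter `s` for which `φ p + s v` lies in the chart target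
(boundaryless model, so that the target is open): it is the composite of the inverse extended
chart, `C^n` on its target, with an affine map. O'Neill 1983, Ch. 1, proof of Prop. 1.16
(coordinate curves). [folklore] -/
theorem contMDiffAt_curveThrough [IsManifold I n M] [I.Boundaryless] (p : M) (v : TangentSpace I p)
    {s : ℝ} (hs : extChartAt I p p + s • (show E from v) ∈ (extChartAt I p).target) :
    ContMDiffAt 𝓘(ℝ, ℝ) I n (curveThrough I p v) s := by
  have h1 : ContMDiffAt 𝓘(ℝ, E) I n (extChartAt I p).symm
      (extChartAt I p p + s • (show E from v)) :=
    (contMDiffOn_extChartAt_symm p).contMDiffAt ((isOpen_extChartAt_target p).mem_nhds hs)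
  have h2 : ContMDiff 𝓘(ℝ, ℝ) 𝓘(ℝ, E) n (fun s : ℝ ↦ extChartAt I p p + s • (show E from v)) :=
    (contDiff_const.add (contDiff_id.smul contDiff_const)).contMDiff
  exact h1.comp s h2.contMDiffAt

omit [IsManifold I ∞ M] in
/-- The chart-straight curve `curveThrough I p v` is `C^n` at `s = 0` (boundaryless model).
[folklore] -/
theorem contMDiffAt_curveThrough_zero [IsManifold I n M] [I.Boundaryless] (p : M)
    (v : TangentSpace I p) : ContMDiffAt 𝓘(ℝ, ℝ) I n (curveThrough I p v) 0 :=
  contMDiffAt_curveThrough p v (by simp)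

end CurveThrough

/-! ### Two-parameter maps -/

section TwoParameter

variable {x : ℝ → ℝ → M} {t₀ s₀ : ℝ} {n : ℕ∞ω}

omit [IsManifold I ∞ M] in
/-- The chart expression `(t, s) ↦ φ(x(t, s))` (`φ` the extended chart at `x(t₀, s₀)`) of a
two-parameter map which is `C^n` at `(t₀, s₀)` is a `C^n` map `ℝ × ℝ → E` at `(t₀, s₀)`; these
are the coordinate functions `xⁱ = xⁱ ∘ x` of O'Neill 1983, Ch. 4, p. 122. [folklore] -/
theorem contDiffAt_extChartAt_uncurry [IsManifold I n M]
    (hx : ContMDiffAt (𝓘(ℝ, ℝ).prod 𝓘(ℝ, ℝ)) I n (uncurry x) (t₀, s₀)) :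
    ContDiffAt ℝ n (fun q : ℝ × ℝ ↦ extChartAt I (x t₀ s₀) (x q.1 q.2)) (t₀, s₀) := by
  have h1 : ContMDiffAt 𝓘(ℝ, ℝ × ℝ) I n (uncurry x) (t₀, s₀) := by
    rw [modelWithCornersSelf_prod, ← chartedSpaceSelf_prod]; exact hx
  have h0 : ContMDiffAt I 𝓘(ℝ, E) n (extChartAt I (x t₀ s₀)) (uncurry x (t₀, s₀)) :=
    contMDiffAt_extChartAt' (mem_chart_source H (x t₀ s₀))
  have h2 : ContMDiffAt 𝓘(ℝ, ℝ × ℝ) 𝓘(ℝ, E) n (extChartAt I (x t₀ s₀) ∘ uncurry x) (t₀, s₀) :=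
    h0.comp (t₀, s₀) h1
  exact contMDiffAt_iff_contDiffAt.1 h2

omit [IsManifold I ∞ M] in
/-- Near `(t₀, s₀)` a two-parameter map continuous at `(t₀, s₀)` stays in the chart domain of
`x(t₀, s₀)`. [folklore] -/
theorem eventually_mem_chartAt_source_uncurry
    (hx : ContMDiffAt (𝓘(ℝ, ℝ).prod 𝓘(ℝ, ℝ)) I n (uncurry x) (t₀, s₀)) :
    ∀ᶠ q : ℝ × ℝ in 𝓝 (t₀, s₀), x q.1 q.2 ∈ (chartAt H (x t₀ s₀)).source :=
  hx.continuousAt.preimage_mem_nhds ((chartAt H (x t₀ s₀)).open_source.mem_nhds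
    (mem_chart_source H (x t₀ s₀)))

omit [IsManifold I ∞ M] in
/-- The `s`-parameter curve `s ↦ x(t₀, s)` of a `C^n` two-parameter map (`n ≠ 0`) is
differentiable at `s₀`. O'Neill 1983, Ch. 4, p. 122 (parameter curves). [folklore] -/
theorem mdifferentiableAt_curry_right
    (hx : ContMDiffAt (𝓘(ℝ, ℝ).prod 𝓘(ℝ, ℝ)) I n (uncurry x) (t₀, s₀)) (hn : n ≠ 0) :
    MDifferentiableAt 𝓘(ℝ, ℝ) I (x t₀) s₀ := by
  have h : ContMDiffAt 𝓘(ℝ, ℝ) (𝓘(ℝ, ℝ).prod 𝓘(ℝ, ℝ)) n (fun s : ℝ ↦ ((t₀, s) : ℝ × ℝ)) s₀ :=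
    contMDiffAt_const.prodMk contMDiffAt_id
  exact (hx.comp s₀ h).mdifferentiableAt hn

omit [IsManifold I ∞ M] in
/-- The `t`-parameter curve `t ↦ x(t, s₀)` of a `C^n` two-parameter map (`n ≠ 0`) is
differentiable at `t₀`. O'Neill 1983, Ch. 4, p. 122 (parameter curves). [folklore] -/
theorem mdifferentiableAt_curry_left
    (hx : ContMDiffAt (𝓘(ℝ, ℝ).prod 𝓘(ℝ, ℝ)) I n (uncurry x) (t₀, s₀)) (hn : n ≠ 0) :
    MDifferentiableAt 𝓘(ℝ, ℝ) I (fun t ↦ x t s₀) t₀ := by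
  have h : ContMDiffAt 𝓘(ℝ, ℝ) (𝓘(ℝ, ℝ).prod 𝓘(ℝ, ℝ)) n (fun t : ℝ ↦ ((t, s₀) : ℝ × ℝ)) t₀ :=
    contMDiffAt_id.prodMk contMDiffAt_const
  exact (hx.comp t₀ h).mdifferentiableAt hn

omit [IsManifold I ∞ M] in
/-- Swapping the two parameters preserves joint regularity. [folklore] -/
theorem contMDiffAt_uncurry_flip
    (hx : ContMDiffAt (𝓘(ℝ, ℝ).prod 𝓘(ℝ, ℝ)) I n (uncurry x) (t₀, s₀)) :
    ContMDiffAt (𝓘(ℝ, ℝ).prod 𝓘(ℝ, ℝ)) I n (uncurry (flip x)) (s₀, t₀) := by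
  have h : ContMDiffAt (𝓘(ℝ, ℝ).prod 𝓘(ℝ, ℝ)) (𝓘(ℝ, ℝ).prod 𝓘(ℝ, ℝ)) n
      (fun q : ℝ × ℝ ↦ (q.2, q.1)) (s₀, t₀) :=
    contMDiffAt_snd.prodMk contMDiffAt_fst
  exact hx.comp (s₀, t₀) h

/-- **Coordinates of the partial velocity `x_s`.** Read in the trivialisation of `TM` at `x₁`,
the velocity of the `s`-parameter curve `s ↦ x(t, s)` at a parameter where the curve is
differentiable and lies in the chart domain of `x₁` is the `s`-derivative of the chart expression
`s ↦ φ(x(t, s))`: O'Neill's `x_v = ∑ (∂xⁱ/∂v) ∂ᵢ` (1983, Ch. 4, p. 122), via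
`hasDerivAt_extChartAt_comp`. [cite: ONeill1983, Ch. 4, p. 122] -/
theorem trivializationAt_velocity_curry_right {x₁ : M} {t s : ℝ}
    (hd : MDifferentiableAt 𝓘(ℝ, ℝ) I (x t) s) (hs : x t s ∈ (chartAt H x₁).source) :
    (trivializationAt E (TangentSpace I) x₁ ⟨x t s, velocity I (x t) s⟩).2 =
      deriv (fun s' ↦ extChartAt I x₁ (x t s')) s :=
  (hasDerivAt_extChartAt_comp hd hs).deriv.symm

/-- **Coordinates of the partial velocity `x_t`**: read in the trivialisation at `x₁`, the
velocity of `t ↦ x(t, s)` is the `t`-derivative of the chart expression (O'Neill 1983, Ch. 4,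
p. 122, `x_u = ∑ (∂xⁱ/∂u) ∂ᵢ`). [cite: ONeill1983, Ch. 4, p. 122] -/
theorem trivializationAt_velocity_curry_left {x₁ : M} {t s : ℝ}
    (hd : MDifferentiableAt 𝓘(ℝ, ℝ) I (fun t' ↦ x t' s) t) (hs : x t s ∈ (chartAt H x₁).source) :
    (trivializationAt E (TangentSpace I) x₁ ⟨x t s, velocity I (fun t' ↦ x t' s) t⟩).2 =
      deriv (fun t' ↦ extChartAt I x₁ (x t' s)) t :=
  (hasDerivAt_extChartAt_comp (γ := fun t' ↦ x t' s) hd hs).deriv.symm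

/-- **The partial velocity `x_s` is a differentiable vector field on the `t`-parameter curve.**
For a two-parameter map `C²` at `(t₀, s₀)`, the lift `t ↦ (x(t, s₀), x_s(t, s₀)) ∈ TM` is
differentiable at `t₀`: its base curve is the differentiable parameter curve, and its fibre
coordinate in the trivialisation at `x(t₀, s₀)` is, near `t₀`, the partial derivative
`∂_s x̂(t, s₀)` of the `C²` chart expression `x̂`, which is differentiable in `t`
(`deriv_deriv_comm_of_contDiffAt`). This is the smoothness of the vector field `x_v` on `x`
(O'Neill 1983, Ch. 4, p. 122) needed to take its covariant derivative along the `u`-curves.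
[cite: ONeill1983, Ch. 4, p. 122] -/
theorem mdifferentiableAt_lift_velocity_curry_right
    (hx : ContMDiffAt (𝓘(ℝ, ℝ).prod 𝓘(ℝ, ℝ)) I 2 (uncurry x) (t₀, s₀)) :
    MDifferentiableAt 𝓘(ℝ, ℝ) I.tangent
      (fun t ↦ (TotalSpace.mk' E (x t s₀) (velocity I (x t) s₀) : TangentBundle I M)) t₀ := by
  have hev : ∀ᶠ q : ℝ × ℝ in 𝓝 (t₀, s₀),
      ContMDiffAt (𝓘(ℝ, ℝ).prod 𝓘(ℝ, ℝ)) I 2 (uncurry x) q :=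
    (contMDiffAt_iff_contMDiffAt_nhds (by decide)).1 hx
  have hsrc := eventually_mem_chartAt_source_uncurry hx
  have hc : Tendsto (fun t : ℝ ↦ ((t, s₀) : ℝ × ℝ)) (𝓝 t₀) (𝓝 (t₀, s₀)) :=
    (continuous_id.prodMk continuous_const).tendsto t₀
  have he : (TotalSpace.mk' E (x t₀ s₀) (velocity I (x t₀) s₀) : TangentBundle I M) ∈
      (trivializationAt E (TangentSpace I : M → Type _) (x t₀ s₀)).source :=
    (Trivialization.mem_source _).2 (FiberBundle.mem_baseSet_trivializationAt' (x t₀ s₀))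
  rw [(trivializationAt E (TangentSpace I : M → Type _) (x t₀ s₀)).mdifferentiableAt_totalSpace_iff
    I (fun t ↦ (TotalSpace.mk' E (x t s₀) (velocity I (x t) s₀) : TangentBundle I M)) he]
  refine ⟨mdifferentiableAt_curry_left hx two_ne_zero, ?_⟩
  have hX := contDiffAt_extChartAt_uncurry hx
  have heq : (fun t ↦ (trivializationAt E (TangentSpace I : M → Type _) (x t₀ s₀)
      ⟨x t s₀, velocity I (x t) s₀⟩).2) =ᶠ[𝓝 t₀]
        fun t ↦ deriv (fun s ↦ extChartAt I (x t₀ s₀) (x t s)) s₀ := by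
    filter_upwards [hc.eventually hev, hc.eventually hsrc] with t ht hts
    exact trivializationAt_velocity_curry_right (mdifferentiableAt_curry_right ht two_ne_zero) hts
  exact mdifferentiableAt_iff_differentiableAt.2
    ((deriv_deriv_comm_of_contDiffAt hX).1.differentiableAt.congr_of_eventuallyEq heq)

/-- **The partial velocity `x_t` is a differentiable vector field on the `s`-parameter curve**:
for a two-parameter map `C²` at `(t₀, s₀)`, the lift `s ↦ (x(t₀, s), x_t(t₀, s)) ∈ TM` is
differentiable at `s₀` (`mdifferentiableAt_lift_velocity_curry_right` for the map with the
parameters swapped). O'Neill 1983, Ch. 4, p. 122. [cite: ONeill1983, Ch. 4, p. 122] -/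
theorem mdifferentiableAt_lift_velocity_curry_left
    (hx : ContMDiffAt (𝓘(ℝ, ℝ).prod 𝓘(ℝ, ℝ)) I 2 (uncurry x) (t₀, s₀)) :
    MDifferentiableAt 𝓘(ℝ, ℝ) I.tangent
      (fun s ↦ (TotalSpace.mk' E (x t₀ s) (velocity I (fun t ↦ x t s) t₀) : TangentBundle I M))
      s₀ :=
  mdifferentiableAt_lift_velocity_curry_right (contMDiffAt_uncurry_flip hx)

/-- **Symmetry lemma for two-parameter maps: `x_{ts} = x_{st}`** (O'Neill 1983, Ch. 4,
Prop. 44 (1): "if `x` is a two-parameter map into a semi-Riemannian manifold, then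
`x_{uv} = x_{vu}`"; Lee, *Riemannian Manifolds*, Lemma 6.2). For a covariant derivative `∇` on
`TM` with vanishing torsion and a two-parameter map `x` which is `C²` at `(t₀, s₀)`, the covariant
derivative at `t₀`, along the `t`-parameter curve `t ↦ x(t, s₀)`, of the partial velocity field
`t ↦ x_s(t, s₀)` equals the covariant derivative at `s₀`, along the `s`-parameter curve
`s ↦ x(t₀, s)`, of `s ↦ x_t(t₀, s)` (both computed by the local-frame formula `covariantDerivAlong`
of `Geodesic.lean`, which is O'Neill's coordinate formula for the induced covariant derivative,
Ch. 3, Prop. 18 and Ch. 4, p. 122). Proof as printed (p. 123): in the coordinate frame `sₖ` of the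
chart at `x(t₀, s₀)`,
`x_{ts} = ∑ₖ {∂_t ∂_s x̂ᵏ + ∑ᵢⱼ Γᵏᵢⱼ x_sⁱ x_tʲ} sₖ` with `Γᵏᵢⱼ sₖ = ∇_{sⱼ} sᵢ`, and this is
symmetric in `t` and `s` since the mixed partials of the `C²` chart expression `x̂` agree
(`deriv_deriv_comm_of_contDiffAt`) and `∇_{sⱼ} sᵢ = ∇_{sᵢ} sⱼ` at the point
(`covariantDerivative_localFrame_comm`, torsion-freeness). [cite: ONeill1983, Ch. 4, Prop. 44 (1)] -/
theorem covariantDerivAlong_velocity_comm [FiniteDimensional ℝ E] [CompleteSpace E]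
    (cov : CovariantDerivative I E (TangentSpace I : M → Type _)) (hcov : cov.torsion = 0)
    (hx : ContMDiffAt (𝓘(ℝ, ℝ).prod 𝓘(ℝ, ℝ)) I 2 (uncurry x) (t₀, s₀)) :
    covariantDerivAlong cov (fun t ↦ x t s₀) (fun t ↦ velocity I (x t) s₀) t₀ =
      covariantDerivAlong cov (x t₀) (fun s ↦ velocity I (fun t ↦ x t s) t₀) s₀ := by
  set e₁ := trivializationAt E (TangentSpace I : M → Type _) (x t₀ s₀) with he₁
  set b := Module.finBasis ℝ E with hb
  set sf : Fin (Module.finrank ℝ E) → Π y : M, TangentSpace I y := e₁.localFrame b with hsf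
  set X : ℝ × ℝ → E := fun q ↦ extChartAt I (x t₀ s₀) (x q.1 q.2) with hX_def
  set Sv : TangentSpace I (x t₀ s₀) := velocity I (x t₀) s₀ with hSv
  set Tv : TangentSpace I (x t₀ s₀) := velocity I (fun t ↦ x t s₀) t₀ with hTv
  set c : Fin (Module.finrank ℝ E) → ℝ → ℝ :=
    fun i t ↦ e₁.localFrame_coeff I b i (x t s₀) (velocity I (x t) s₀) with hc_def
  set d : Fin (Module.finrank ℝ E) → ℝ → ℝ :=
    fun i s ↦ e₁.localFrame_coeff I b i (x t₀ s) (velocity I (fun t ↦ x t s) t₀) with hd_def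
  have hX : ContDiffAt ℝ 2 X (t₀, s₀) := contDiffAt_extChartAt_uncurry hx
  have hx₁ : x t₀ s₀ ∈ e₁.baseSet := FiberBundle.mem_baseSet_trivializationAt' (x t₀ s₀)
  -- eventual regularity along the two parameter lines
  have hev : ∀ᶠ q : ℝ × ℝ in 𝓝 (t₀, s₀),
      ContMDiffAt (𝓘(ℝ, ℝ).prod 𝓘(ℝ, ℝ)) I 2 (uncurry x) q :=
    (contMDiffAt_iff_contMDiffAt_nhds (by decide)).1 hx
  have hsrc := eventually_mem_chartAt_source_uncurry hx
  have hl₁ : Tendsto (fun t : ℝ ↦ ((t, s₀) : ℝ × ℝ)) (𝓝 t₀) (𝓝 (t₀, s₀)) :=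
    (continuous_id.prodMk continuous_const).tendsto t₀
  have hl₂ : Tendsto (fun s : ℝ ↦ ((t₀, s) : ℝ × ℝ)) (𝓝 s₀) (𝓝 (t₀, s₀)) :=
    (continuous_const.prodMk continuous_id).tendsto s₀
  -- the coefficient functions are the partial derivatives of the chart expression
  have hc : ∀ i, c i =ᶠ[𝓝 t₀] fun t ↦ b.coord i (deriv (fun s ↦ X (t, s)) s₀) := by
    intro i
    filter_upwards [hl₁.eventually hev, hl₁.eventually hsrc] with t ht hts
    have hts' : x t s₀ ∈ e₁.baseSet := by simpa [he₁] using hts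
    simp only [hc_def]
    rw [e₁.localFrame_coeff_eq_coeff (b := b) (s := fun _ ↦ velocity I (x t) s₀) hts',
      trivializationAt_velocity_curry_right (mdifferentiableAt_curry_right ht two_ne_zero) hts]
    rfl
  have hd : ∀ i, d i =ᶠ[𝓝 s₀] fun s ↦ b.coord i (deriv (fun t ↦ X (t, s)) t₀) := by
    intro i
    filter_upwards [hl₂.eventually hev, hl₂.eventually hsrc] with s hs hss
    have hss' : x t₀ s ∈ e₁.baseSet := by simpa [he₁] using hss
    simp only [hd_def]
    rw [e₁.localFrame_coeff_eq_coeff (b := b) (s := fun _ ↦ velocity I (fun t ↦ x t s) t₀) hss',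
      trivializationAt_velocity_curry_left (mdifferentiableAt_curry_left hs two_ne_zero) hss]
    rfl
  have hmixed := deriv_deriv_comm_of_contDiffAt hX
  have hcd : ∀ i, deriv (c i) t₀ = deriv (d i) s₀ := by
    intro i
    have h1 : HasDerivAt (fun t ↦ b.coord i (deriv (fun s ↦ X (t, s)) s₀))
        (b.coord i ((fderiv ℝ (fderiv ℝ X) (t₀, s₀) (1, 0)) (0, 1))) t₀ :=
      ((b.coord i).toContinuousLinearMap).hasFDerivAt.comp_hasDerivAt t₀ hmixed.1
    have h2 : HasDerivAt (fun s ↦ b.coord i (deriv (fun t ↦ X (t, s)) t₀))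
        (b.coord i ((fderiv ℝ (fderiv ℝ X) (t₀, s₀) (1, 0)) (0, 1))) s₀ :=
      ((b.coord i).toContinuousLinearMap).hasFDerivAt.comp_hasDerivAt s₀ hmixed.2
    rw [(hc i).deriv_eq, (hd i).deriv_eq, h1.deriv, h2.deriv]
  -- expansions of the two partial velocities at the base point in the frame
  have hS : Sv = ∑ j, e₁.localFrame_coeff I b j (x t₀ s₀) Sv • sf j (x t₀ s₀) := by
    simpa only using e₁.eq_sum_localFrame_coeff_smul (I := I) (b := b) (s := fun _ ↦ Sv) hx₁
  have hT : Tv = ∑ j, e₁.localFrame_coeff I b j (x t₀ s₀) Tv • sf j (x t₀ s₀) := by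
    simpa only using e₁.eq_sum_localFrame_coeff_smul (I := I) (b := b) (s := fun _ ↦ Tv) hx₁
  -- symmetry of the Christoffel symbols
  have hΓ : ∀ i j, cov (sf j) (x t₀ s₀) (sf i (x t₀ s₀)) = cov (sf i) (x t₀ s₀) (sf j (x t₀ s₀)) :=
    fun i j ↦ covariantDerivative_localFrame_comm cov hcov b (x t₀ s₀) i j
  -- the frame formulas for both sides
  have hL : covariantDerivAlong cov (fun t ↦ x t s₀) (fun t ↦ velocity I (x t) s₀) t₀ =
      ∑ i, deriv (c i) t₀ • sf i (x t₀ s₀) +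
        ∑ i, e₁.localFrame_coeff I b i (x t₀ s₀) Sv • cov (sf i) (x t₀ s₀) Tv := rfl
  have hR : covariantDerivAlong cov (x t₀) (fun s ↦ velocity I (fun t ↦ x t s) t₀) s₀ =
      ∑ i, deriv (d i) s₀ • sf i (x t₀ s₀) +
        ∑ i, e₁.localFrame_coeff I b i (x t₀ s₀) Tv • cov (sf i) (x t₀ s₀) Sv := rfl
  rw [hL, hR]
  congr 1
  · exact Finset.sum_congr rfl fun i _ ↦ by rw [hcd i]
  · calc ∑ i, e₁.localFrame_coeff I b i (x t₀ s₀) Sv • cov (sf i) (x t₀ s₀) Tv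
        = ∑ i, e₁.localFrame_coeff I b i (x t₀ s₀) Sv •
            cov (sf i) (x t₀ s₀) (∑ j, e₁.localFrame_coeff I b j (x t₀ s₀) Tv • sf j (x t₀ s₀)) := by
          rw [← hT]
      _ = ∑ i, ∑ j, (e₁.localFrame_coeff I b i (x t₀ s₀) Sv *
            e₁.localFrame_coeff I b j (x t₀ s₀) Tv) • cov (sf i) (x t₀ s₀) (sf j (x t₀ s₀)) := by
          refine Finset.sum_congr rfl fun i _ ↦ ?_
          rw [map_sum, Finset.smul_sum]
          refine Finset.sum_congr rfl fun j _ ↦ ?_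
          rw [map_smul, smul_smul]
      _ = ∑ j, ∑ i, (e₁.localFrame_coeff I b j (x t₀ s₀) Tv *
            e₁.localFrame_coeff I b i (x t₀ s₀) Sv) • cov (sf j) (x t₀ s₀) (sf i (x t₀ s₀)) := by
          rw [Finset.sum_comm]
          refine Finset.sum_congr rfl fun j _ ↦ Finset.sum_congr rfl fun i _ ↦ ?_
          rw [hΓ i j, mul_comm]
      _ = ∑ j, e₁.localFrame_coeff I b j (x t₀ s₀) Tv •
            cov (sf j) (x t₀ s₀) (∑ i, e₁.localFrame_coeff I b i (x t₀ s₀) Sv • sf i (x t₀ s₀)) := by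
          refine Finset.sum_congr rfl fun j _ ↦ ?_
          rw [map_sum, Finset.smul_sum]
          refine Finset.sum_congr rfl fun i _ ↦ ?_
          rw [map_smul, smul_smul]
      _ = ∑ j, e₁.localFrame_coeff I b j (x t₀ s₀) Tv • cov (sf j) (x t₀ s₀) Sv := by
          rw [← hS]

end TwoParameter

end Literature.Geometry.Lorentzian

end
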